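import Summits.QuantumFields.YangMills.Theorems.BalabanUVNodesN21GappedTopPair13CoPH
import Summits.QuantumFields.YangMills.Theorems.BalabanUVNodesN21GappedTopCut13CoPHCount
import Summits.QuantumFields.YangMills.Theorems.BalabanUVNodesN21JointLetterSelection

/-!
# N21 (NE7c) · THE GAPPED TOP CUT FOR BOTH INDICATOR FAMILIES — the count: unity ON THE GRAPH kills BOTH top letters, so the two-collar shells summed over the
# top histories are at most an a-MAJORANT (no (3.3) letter in it) PLUS a b-MAJORANT (no (3.2) letter in it); each majorant family counts every χ_{k+1}-cube at
# most twice along ITS OWN geometric grid; hence the two depths are selected SEPARATELY, common to two runs — (M1)-FREE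

WIDTH SEAT `pub-ymgap-dag-n21-w7` (g2), node N21 = NE7c (NOT PRINTED; NOT proved at print's fixed thresholds); lane K3⁸ `SpineGivenEndpointR13SepCoPHV`
(stmt-QuantumFields-27366; K3⁷ 20544 aside — KEY MAP v2), `--supports … --as helper`; COUNT-NEUTRAL.  THEOREMS ONLY (0 `def`).  Imports this seat's U2²
`…N21GappedTopPair13CoPH` (covers + graph), the lane owner dag-n21-d's U3 `…N21GappedTopCut13CoPHCount` (p619723: `cutGrid_succ_le_of_nonneg`, `sum_range_sub_shift_two_le_two`,
`sum_range_collarAt_cutGrid_le`, `card_Iχ_top_le`) and this seat's generic `…N21JointLetterSelection` (p623373: `exists_common_single_le`, the two-run common argmin on one grid).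
OFFER-2 of the lane owner (cell bus 2026-08-28 10:02Z) + this seat's CORRECTION-1: at the MAJORANT level the two families SEPARATE — `i⋆` and `j⋆` are two one-grid argmins.

WHAT THIS FILE PROVES ([folklore] finite-sum ∕ measure bookkeeping; every row displayed; `h_s(U) := χ_k(s)(U)·slot_k^{t}(s)(U)` the old pieces, `Z := Σ_s ∫ h_s = Σ_s classWeight_k(s)`).
* §Q1 ★★ `sum_topGap2ShellAt_le_integral_collar2`: at the top `k + 1 = p.K`, for `θlo ≤ θ ≤ θhi`, `δlo ≤ δ′ ≤ δhi`,
  `Σ_{s′} shell2(s′) ≤ ∫ Σ_s (collarA(θlo,θhi)(Ū) + collarB(δlo,δhi)(s)(U,Ū))·h_s(U) dU` — U2²'s graph bound, the fibres of `init`, and the unity law of the PAIR-LETTERED step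
  weights on the graph (`isStepUnity_wTop2At`): NEITHER top letter survives on the right.
* §Q2 `sum_range_collarBAt_bCutGrid_le`: along `δ′_j = 2δ_k(1−ρ′)^j` the (3.3) collars `[δ′_{j+2}, δ′_j)`, `j < m`, count every χ_{k+1}-cube at most twice (NO sign hypothesis).
* §Q3 ★★ `sum_topGap2ShellAt_le_majorants`: `Σ_{s′} shell2 ≤ Mᵃ(θlo,θhi) + Mᵇ(δlo,δhi)` with `Mᵃ := ∫ collarA(Ū)·Σ_s h_s(U) dU` (U3's majorant, free of the (3.3) letters) and
  `Mᵇ := ∫ Σ_s collarB_s(U,Ū)·h_s(U) dU` (free of the (3.2) letters).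
* §Q4 ★ `sum_range_majorantA_le` (`Σ_{i<m} Mᵃ(θ_{i+2},θ_i) ≤ 2(2L^m)⁴·Z`, U3's count) and ★ `sum_range_majorantB_le` (`Σ_{j<m} Mᵇ(δ′_{j+2},δ′_j) ≤ 2(2L^m)⁴·Z`, §Q2).
* §Q5 ★★★ `exists_common_depths_topGap2Shell_le` — TWO RUNS of one tuple (run `r` at its top `k_r + 1 = p_r.K`), widths `ρ, ρ′ ∈ [0,1]`, depth budgets `n₁, n₂`, signs `0 ≤ ε_top`,
  `0 ≤ δ_top`: SOME `i ≤ n₁` AND SOME `j ≤ n₂`, common to both runs, have `Σ_{s′} shell2ʳ(θʳ_{i+2},θʳ_{i+1},θʳ_i; δ′ʳ_{j+2},δ′ʳ_{j+1},δ′ʳ_j) ≤ 4(2L^m)⁴·(1∕(n₁+1) + 1∕(n₂+1))·Zʳ` in EACH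
  run — the two runs then read BOTH top indicator families at COMMON relative letters with both collars EMPTY of top statistics on the doubly-gapped cores: the single-run
  half of `T4IndicatorShell` design (i) for the whole indicator content of the last 𝐓-step except `ζ` ∕ (3.5) and the 𝐑-step, (M1)-FREE.

HONEST FRAMING (binding).  [folklore] bookkeeping; NO anti-concentration, NO estimate of Bałaban's; rows displayed (`0 ≤ ζ`, `Σ|ζ| ≤ 1`, `Σζ = 1`, (H-ζ), (e1) at level `k`,
`0 ≤ ρ, ρ′ ≤ 1`, `0 ≤ ε_top`, `0 ≤ δ_top`); the residual `ζ`, the ℝ-side, the selector and everything below the top step NOT re-lettered (LOCATED); the READING carrying the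
selected pair and the two-run comparison (closeness, site identification, core sandwich = NE7 proper) are the lane owner's ∕ the consumer's; NE7c NOT PRINTED ∕ NOT proved at
print's FIXED thresholds; N21 NOT discharged; K3⁸ NOT claimed; counts UNMOVED (typed 28∕28 · discharged 5∕27, A 5∕28); never a count claim.  No `sorry`, no `axiom`, no `def`,
no `instance`, no `notation`.  One finite four-torus programme at fixed `ε` — NOT ℝ⁴, NOT OS, NOT a mass gap, NOT the Clay problem.
-/

noncomputable section

open scoped BigOperators
open Finset MeasureTheory

namespace Summit.QuantumFields.YangMills.Theorems.N21GappedTopPair13CoPH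

open Literature.MathematicalPhysics.QuantumFieldTheory.Balaban1983to89
open Literature.MathematicalPhysics.QuantumFieldTheory.Balaban1983to89.T4Continuum
open Literature.MathematicalPhysics.QuantumFieldTheory.Balaban1983to89.Node00
open Summit.QuantumFields.YangMills.BalabanUVNodes.N19MGFRoadLiveSelectorTower (dressedSlotsOfDatum₉_nonneg)
open Summit.QuantumFields.YangMills.BalabanUVNodes.N19MGFFormAtRecord (wOfRecord₉_nonneg)
open Summit.QuantumFields.YangMills.Theorems.N21ShellSplitOfRecord13CoPH
open Summit.QuantumFields.YangMills.Theorems.N21JointLetterSelection (exists_common_single_le)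

/-! ## §Q1 The sum over the top histories: unity ON THE GRAPH kills both top letters -/

section SumHistories2

variable (F : T4Family) (N : ℕ) [NeZero N] (ϑ : Stage9Params F N) (D : FiniteEpsData F (SU N)) (g₀ : ℕ → ℝ) (os : List (ULoop F))
  (p : B12.RunParams) (g : ℕ → ℝ) (k : ℕ)

/-- ★★ **THE SUM OF THE TWO-COLLAR SHELLS OVER THE TOP HISTORIES**: at the top `k + 1 = p.K`, for `θlo ≤ θ ≤ θhi`, `δlo ≤ δ′ ≤ δhi`,
`Σ_{s′} shell2(s′) ≤ ∫ Σ_s (collarA(θlo,θhi)(Ū) + collarB(δlo,δhi)(s)(U,Ū)) · χ_k(s)(U)·slot_k^{t}(s)(U) dU` — U2²'s graph bound, the fibres of `init` (the (3.3) collar of `s′`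
reads `init s′ = s`), and the unity law of the pair-lettered step weights on the graph.  Rows: `0 ≤ ζ`, `Σ|ζ| ≤ 1`, `Σζ = 1`, (H-ζ), (e1) at level `k`. [bookkeeping] -/
theorem sum_topGap2ShellAt_le_integral_collar2 (hk : k + 1 = p.K) (hζ0 : ∀ p g k s Pl Ql RS U V', 0 ≤ ϑ.ζ p g k s Pl Ql RS U V') (hζm : ZetaMeasurable F N ϑ.ζ)
    (hζ1 : IsZetaAbsLeOne F N ϑ.ν ϑ.τ9.M ϑ.ζ) (hζu : IsZetaUnity F N ϑ.ν ϑ.τ9.M ϑ.ζ) {θlo θ θhi δlo δ' δhi : ℝ} (hθlo : θlo ≤ θ) (hθhi : θ ≤ θhi)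
    (hδlo : δlo ≤ δ') (hδhi : δ' ≤ δhi) (t : ℝ)
    (hint : ∀ s : SeqOfRecord F ϑ.ν ϑ.τ9.M g p.K k,
      Integrable (fun U => chiSeqOfRecord F N ϑ.ν ϑ.τ9.M g p.K k s U * dressedSlotsOfDatum₉ F N ϑ D g₀ os t p g k s U) (fieldMeasure (F.P p.K) k (SU N))) :
    ∑ s', topGap2ShellAt F N ϑ D g₀ os p g k θlo θ θhi δlo δ' δhi t s' ≤
      ∫ U, ∑ s, (collarAt F N ϑ.ν p g k θlo θhi ((avOfRecord F N p.K k).avg U) +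
          collarBAt F N ϑ.ν ϑ.τ9.M p g k δlo δhi s U ((avOfRecord F N p.K k).avg U)) *
        (chiSeqOfRecord F N ϑ.ν ϑ.τ9.M g p.K k s U * dressedSlotsOfDatum₉ F N ϑ D g₀ os t p g k s U) ∂fieldMeasure (F.P p.K) k (SU N) := by
  classical
  have hk' : k < p.K := by omega
  have hU : LocalBgMeasurable F N ϑ.ν := localBgMeasurable F N ϑ.ν
  set avg := (avOfRecord F N p.K k).avg with havg
  -- the graph integrands and their integrability
  set G : SeqOfRecord F ϑ.ν ϑ.τ9.M g p.K (k + 1) → GaugeField (F.P p.K) k (SU N) → ℝ := fun s' U =>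
    (chiSeqOfRecord F N ϑ.ν ϑ.τ9.M g p.K k s'.init U * dressedSlotsOfDatum₉ F N ϑ D g₀ os t p g k s'.init U) *
      ((collarAt F N ϑ.ν p g k θlo θhi (avg U) + collarBAt F N ϑ.ν ϑ.τ9.M p g k δlo δhi s'.init U (avg U)) *
        (chiSeqOfRecordAt F N ϑ.ν ϑ.τ9.M g p.K (k + 1) θ s' (avg U) * wTop2At F N ϑ θ δ' p g k s' U (avg U))) with hG
  have hGint : ∀ s', Integrable (G s') (fieldMeasure (F.P p.K) k (SU N)) := fun s' =>
    integrable_oldPiece_mul_graph F N ϑ D g₀ os p g k t hint s'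
      (b := fun z => (collarAt F N ϑ.ν p g k θlo θhi z.1 + collarBAt F N ϑ.ν ϑ.τ9.M p g k δlo δhi s'.init z.2 z.1) *
        (chiSeqOfRecordAt F N ϑ.ν ϑ.τ9.M g p.K (k + 1) θ s' z.1 * wTop2At F N ϑ θ δ' p g k s' z.2 z.1))
      ((((measurable_collarAt F N ϑ.ν p g k θlo θhi).comp measurable_fst).add (measurable_collarBAt F N ϑ.ν ϑ.τ9.M p g k δlo δhi s'.init)).mul
        ((((measurable_chiSeqOfRecordAt_of_localBg hU ϑ.τ9.M g p.K (k + 1) θ s').comp measurable_fst).mul (measurable_wTop2At F N ϑ p g k hζm θ δ' s'))))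
      (C := 2 * Fintype.card (Iχ F ϑ.ν p g k)) (fun z => by
        rw [Real.norm_eq_abs, abs_mul, abs_mul]
        have hA := abs_collarAt_le_card F N ϑ.ν p g k θlo θhi z.1
        have hB := abs_collarBAt_le_card F N ϑ.ν ϑ.τ9.M p g k δlo δhi s'.init z.2 z.1
        have hAB : |collarAt F N ϑ.ν p g k θlo θhi z.1 + collarBAt F N ϑ.ν ϑ.τ9.M p g k δlo δhi s'.init z.2 z.1| ≤ 2 * Fintype.card (Iχ F ϑ.ν p g k) :=
          (abs_add_le _ _).trans (by linarith)
        calc |collarAt F N ϑ.ν p g k θlo θhi z.1 + collarBAt F N ϑ.ν ϑ.τ9.M p g k δlo δhi s'.init z.2 z.1| *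
              (|chiSeqOfRecordAt F N ϑ.ν ϑ.τ9.M g p.K (k + 1) θ s' z.1| * |wTop2At F N ϑ θ δ' p g k s' z.2 z.1|)
            ≤ (2 * Fintype.card (Iχ F ϑ.ν p g k) : ℝ) * (1 * 1) :=
              mul_le_mul hAB
                (mul_le_mul (abs_chiSeqOfRecordAt_le_one F N ϑ.ν ϑ.τ9.M g p.K (k + 1) θ s' z.1) (abs_wTop2At_le_one F N ϑ p g k hζ1 θ δ' s' z.2 z.1)
                  (abs_nonneg _) zero_le_one)
                (mul_nonneg (abs_nonneg _) (abs_nonneg _)) (by positivity)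
          _ = 2 * Fintype.card (Iχ F ϑ.ν p g k) := by ring)
  -- the unity law of the pair-lettered step weights on the graph, at the letters of the top
  have hunit := isStepUnity_wTop2At F N ϑ p g k hζu θ δ'
  have hlow := chiSeqOfRecordAt_topLetter_of_lt F N ϑ p g k hk' θ
  have htop : topLetter ϑ.ν θ p g (k + 1) = θ := by rw [hk]; exact topLetter_top ϑ.ν θ p g
  rw [hlow, htop] at hunit
  -- pointwise identity on the old field space
  have hpt : ∀ U, ∑ s', G s' U = ∑ s, (collarAt F N ϑ.ν p g k θlo θhi (avg U) + collarBAt F N ϑ.ν ϑ.τ9.M p g k δlo δhi s U (avg U)) *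
      (chiSeqOfRecord F N ϑ.ν ϑ.τ9.M g p.K k s U * dressedSlotsOfDatum₉ F N ϑ D g₀ os t p g k s U) := by
    intro U
    rw [B14.Eq218Concrete.Seq.sum_seq_succ_fiber]
    refine Finset.sum_congr rfl fun s _ => ?_
    have hu := hunit s U
    calc ∑ s' ∈ Finset.univ.filter (fun s' : SeqOfRecord F ϑ.ν ϑ.τ9.M g p.K (k + 1) => s'.init = s), G s' U
        = ∑ s' ∈ Finset.univ.filter (fun s' : SeqOfRecord F ϑ.ν ϑ.τ9.M g p.K (k + 1) => s'.init = s),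
            ((collarAt F N ϑ.ν p g k θlo θhi (avg U) + collarBAt F N ϑ.ν ϑ.τ9.M p g k δlo δhi s U (avg U)) *
                dressedSlotsOfDatum₉ F N ϑ D g₀ os t p g k s U) *
              (chiSeqOfRecord F N ϑ.ν ϑ.τ9.M g p.K k s U *
                (chiSeqOfRecordAt F N ϑ.ν ϑ.τ9.M g p.K (k + 1) θ s' (avg U) * wTop2At F N ϑ θ δ' p g k s' U (avg U))) := by
          refine Finset.sum_congr rfl fun s' hs' => ?_
          rw [hG]
          simp only
          rw [(Finset.mem_filter.1 hs').2]
          ring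
      _ = ((collarAt F N ϑ.ν p g k θlo θhi (avg U) + collarBAt F N ϑ.ν ϑ.τ9.M p g k δlo δhi s U (avg U)) *
            dressedSlotsOfDatum₉ F N ϑ D g₀ os t p g k s U) * chiSeqOfRecord F N ϑ.ν ϑ.τ9.M g p.K k s U := by
          rw [← Finset.mul_sum, ← Finset.mul_sum, hu]
      _ = (collarAt F N ϑ.ν p g k θlo θhi (avg U) + collarBAt F N ϑ.ν ϑ.τ9.M p g k δlo δhi s U (avg U)) *
            (chiSeqOfRecord F N ϑ.ν ϑ.τ9.M g p.K k s U * dressedSlotsOfDatum₉ F N ϑ D g₀ os t p g k s U) := by ring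
  calc ∑ s', topGap2ShellAt F N ϑ D g₀ os p g k θlo θ θhi δlo δ' δhi t s'
      ≤ ∑ s', ∫ U, G s' U ∂fieldMeasure (F.P p.K) k (SU N) :=
        Finset.sum_le_sum fun s' _ => topGap2ShellAt_le_graph_collar2 F N ϑ D g₀ os p g k hk hζ0 hζm hζ1 hθlo hθhi hδlo hδhi t hint s'
    _ = ∫ U, ∑ s', G s' U ∂fieldMeasure (F.P p.K) k (SU N) := (integral_finsetSum _ fun s' _ => hGint s').symm
    _ = _ := integral_congr_ae (ae_of_all _ hpt)

end SumHistories2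

/-! ## §Q2 The (3.3) collar count along the geometric grid of (3.3) letters -/

section CollarCountB

variable (F : T4Family) (N : ℕ) [NeZero N] (ν : Stage7Numerics) (M : ℕ) (A₁ : ℝ) (p : B12.RunParams) (g : ℕ → ℝ) (k : ℕ)

/-- **ALONG THE GRID `δ′_j = 2δ_k(1 − ρ′)^j` THE (3.3) COLLARS `[δ′_{j+2}, δ′_j)`, `j < m`, COUNT EVERY χ_{k+1}-CUBE AT MOST TWICE**:
`Σ_{j<m} collarB(δ′_{j+2}, δ′_j)(s)(U,V′) ≤ 2 · #cubes` (swap the sums; each cube's (3.3) indicator lies in `[0,1]`, U3's telescoping in steps of two). NO sign hypothesis.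
[bookkeeping] -/
theorem sum_range_collarBAt_bCutGrid_le (ρ' : ℝ) (m : ℕ) (s : SeqOfRecord F ν M g p.K k) (U : GaugeField (F.P p.K) k (SU N))
    (V' : GaugeField (F.P p.K) (k + 1) (SU N)) :
    ∑ j ∈ Finset.range m, collarBAt F N ν M p g k (bCutGrid ν A₁ g k ρ' (j + 2)) (bCutGrid ν A₁ g k ρ' j) s U V' ≤ 2 * Fintype.card (Iχ F ν p g k) := by
  unfold collarBAt
  rw [Finset.sum_comm]
  calc ∑ c : Iχ F ν p g k, ∑ j ∈ Finset.range m,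
        (bFactorAt F N ν M p g k (bCutGrid ν A₁ g k ρ' j) s c U V' - bFactorAt F N ν M p g k (bCutGrid ν A₁ g k ρ' (j + 2)) s c U V')
      ≤ ∑ _c : Iχ F ν p g k, (2 : ℝ) := Finset.sum_le_sum fun c _ =>
          sum_range_sub_shift_two_le_two (x := fun j => bFactorAt F N ν M p g k (bCutGrid ν A₁ g k ρ' j) s c U V')
            (fun j => bFactorAt_nonneg F N ν M p g k _ s c U V') (fun j => bFactorAt_le_one F N ν M p g k _ s c U V') m
    _ = 2 * Fintype.card (Iχ F ν p g k) := by rw [Finset.sum_const, nsmul_eq_mul, Finset.card_univ, mul_comm]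

end CollarCountB

/-! ## §Q3 The two majorants: the (3.2) letters and the (3.3) letters SEPARATE -/

section Majorants

variable (F : T4Family) (N : ℕ) [NeZero N] (ϑ : Stage9Params F N) (D : FiniteEpsData F (SU N)) (g₀ : ℕ → ℝ) (os : List (ULoop F))
  (p : B12.RunParams) (g : ℕ → ℝ) (k : ℕ)

/-- integrability of an old piece times the (3.2) collar count on the graph (bounded by `#cubes`, measurable). [bookkeeping] -/
theorem integrable_oldPiece_mul_collarA (θlo θhi t : ℝ)
    (hint : ∀ s : SeqOfRecord F ϑ.ν ϑ.τ9.M g p.K k,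
      Integrable (fun U => chiSeqOfRecord F N ϑ.ν ϑ.τ9.M g p.K k s U * dressedSlotsOfDatum₉ F N ϑ D g₀ os t p g k s U) (fieldMeasure (F.P p.K) k (SU N)))
    (s : SeqOfRecord F ϑ.ν ϑ.τ9.M g p.K k) :
    Integrable (fun U => (chiSeqOfRecord F N ϑ.ν ϑ.τ9.M g p.K k s U * dressedSlotsOfDatum₉ F N ϑ D g₀ os t p g k s U) *
      collarAt F N ϑ.ν p g k θlo θhi ((avOfRecord F N p.K k).avg U)) (fieldMeasure (F.P p.K) k (SU N)) :=
  integrable_graph_piece (avOfRecord_measurable F N p.K k) (hint s) (b := fun z => collarAt F N ϑ.ν p g k θlo θhi z.1)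
    ((measurable_collarAt F N ϑ.ν p g k θlo θhi).comp measurable_fst) (C := Fintype.card (Iχ F ϑ.ν p g k))
    (fun z => by rw [Real.norm_eq_abs]; exact abs_collarAt_le_card F N ϑ.ν p g k θlo θhi z.1)

/-- integrability of an old piece times the (3.3) collar count on the graph (bounded by `#cubes`, jointly measurable). [bookkeeping] -/
theorem integrable_oldPiece_mul_collarB (δlo δhi t : ℝ)
    (hint : ∀ s : SeqOfRecord F ϑ.ν ϑ.τ9.M g p.K k,
      Integrable (fun U => chiSeqOfRecord F N ϑ.ν ϑ.τ9.M g p.K k s U * dressedSlotsOfDatum₉ F N ϑ D g₀ os t p g k s U) (fieldMeasure (F.P p.K) k (SU N)))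
    (s : SeqOfRecord F ϑ.ν ϑ.τ9.M g p.K k) :
    Integrable (fun U => (chiSeqOfRecord F N ϑ.ν ϑ.τ9.M g p.K k s U * dressedSlotsOfDatum₉ F N ϑ D g₀ os t p g k s U) *
      collarBAt F N ϑ.ν ϑ.τ9.M p g k δlo δhi s U ((avOfRecord F N p.K k).avg U)) (fieldMeasure (F.P p.K) k (SU N)) :=
  integrable_graph_piece (avOfRecord_measurable F N p.K k) (hint s) (b := fun z => collarBAt F N ϑ.ν ϑ.τ9.M p g k δlo δhi s z.2 z.1)
    (measurable_collarBAt F N ϑ.ν ϑ.τ9.M p g k δlo δhi s) (C := Fintype.card (Iχ F ϑ.ν p g k))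
    (fun z => by rw [Real.norm_eq_abs]; exact abs_collarBAt_le_card F N ϑ.ν ϑ.τ9.M p g k δlo δhi s z.2 z.1)

/-- ★★ **THE TWO-COLLAR SHELLS ARE BELOW AN a-MAJORANT PLUS A b-MAJORANT**: at the top, for `θlo ≤ θ ≤ θhi`, `δlo ≤ δ′ ≤ δhi`,
`Σ_{s′} shell2 ≤ ∫ collarA(θlo,θhi)(Ū)·Σ_s h_s(U) dU + ∫ Σ_s collarB(δlo,δhi)(s)(U,Ū)·h_s(U) dU` — the first term has NO (3.3) letter in it (it is U3's majorant of the (3.2) family),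
the second NO (3.2) letter: the families SEPARATE at the majorant level. [bookkeeping] -/
theorem sum_topGap2ShellAt_le_majorants (hk : k + 1 = p.K) (hζ0 : ∀ p g k s Pl Ql RS U V', 0 ≤ ϑ.ζ p g k s Pl Ql RS U V') (hζm : ZetaMeasurable F N ϑ.ζ)
    (hζ1 : IsZetaAbsLeOne F N ϑ.ν ϑ.τ9.M ϑ.ζ) (hζu : IsZetaUnity F N ϑ.ν ϑ.τ9.M ϑ.ζ) {θlo θ θhi δlo δ' δhi : ℝ} (hθlo : θlo ≤ θ) (hθhi : θ ≤ θhi)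
    (hδlo : δlo ≤ δ') (hδhi : δ' ≤ δhi) (t : ℝ)
    (hint : ∀ s : SeqOfRecord F ϑ.ν ϑ.τ9.M g p.K k,
      Integrable (fun U => chiSeqOfRecord F N ϑ.ν ϑ.τ9.M g p.K k s U * dressedSlotsOfDatum₉ F N ϑ D g₀ os t p g k s U) (fieldMeasure (F.P p.K) k (SU N))) :
    ∑ s', topGap2ShellAt F N ϑ D g₀ os p g k θlo θ θhi δlo δ' δhi t s' ≤
      (∫ U, collarAt F N ϑ.ν p g k θlo θhi ((avOfRecord F N p.K k).avg U) *
          ∑ s, chiSeqOfRecord F N ϑ.ν ϑ.τ9.M g p.K k s U * dressedSlotsOfDatum₉ F N ϑ D g₀ os t p g k s U ∂fieldMeasure (F.P p.K) k (SU N)) +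
        ∫ U, ∑ s, collarBAt F N ϑ.ν ϑ.τ9.M p g k δlo δhi s U ((avOfRecord F N p.K k).avg U) *
          (chiSeqOfRecord F N ϑ.ν ϑ.τ9.M g p.K k s U * dressedSlotsOfDatum₉ F N ϑ D g₀ os t p g k s U) ∂fieldMeasure (F.P p.K) k (SU N) := by
  have hA := fun s => integrable_oldPiece_mul_collarA F N ϑ D g₀ os p g k θlo θhi t hint s
  have hB := fun s => integrable_oldPiece_mul_collarB F N ϑ D g₀ os p g k δlo δhi t hint s
  have hA' : Integrable (fun U => collarAt F N ϑ.ν p g k θlo θhi ((avOfRecord F N p.K k).avg U) *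
      ∑ s, chiSeqOfRecord F N ϑ.ν ϑ.τ9.M g p.K k s U * dressedSlotsOfDatum₉ F N ϑ D g₀ os t p g k s U) (fieldMeasure (F.P p.K) k (SU N)) := by
    refine (integrable_finsetSum Finset.univ fun s _ => hA s).congr (ae_of_all _ fun U => ?_)
    show ∑ s, (chiSeqOfRecord F N ϑ.ν ϑ.τ9.M g p.K k s U * dressedSlotsOfDatum₉ F N ϑ D g₀ os t p g k s U) *
        collarAt F N ϑ.ν p g k θlo θhi ((avOfRecord F N p.K k).avg U) = _
    beta_reduce
    rw [Finset.mul_sum]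
    exact Finset.sum_congr rfl fun s _ => mul_comm _ _
  have hB' : Integrable (fun U => ∑ s, collarBAt F N ϑ.ν ϑ.τ9.M p g k δlo δhi s U ((avOfRecord F N p.K k).avg U) *
      (chiSeqOfRecord F N ϑ.ν ϑ.τ9.M g p.K k s U * dressedSlotsOfDatum₉ F N ϑ D g₀ os t p g k s U)) (fieldMeasure (F.P p.K) k (SU N)) := by
    refine (integrable_finsetSum Finset.univ fun s _ => hB s).congr (ae_of_all _ fun U => ?_)
    show ∑ s, (chiSeqOfRecord F N ϑ.ν ϑ.τ9.M g p.K k s U * dressedSlotsOfDatum₉ F N ϑ D g₀ os t p g k s U) *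
        collarBAt F N ϑ.ν ϑ.τ9.M p g k δlo δhi s U ((avOfRecord F N p.K k).avg U) = _
    exact Finset.sum_congr rfl fun s _ => mul_comm _ _
  refine (sum_topGap2ShellAt_le_integral_collar2 F N ϑ D g₀ os p g k hk hζ0 hζm hζ1 hζu hθlo hθhi hδlo hδhi t hint).trans (le_of_eq ?_)
  rw [← integral_add hA' hB']
  refine integral_congr_ae (ae_of_all _ fun U => ?_)
  show ∑ s, (collarAt F N ϑ.ν p g k θlo θhi ((avOfRecord F N p.K k).avg U) +
        collarBAt F N ϑ.ν ϑ.τ9.M p g k δlo δhi s U ((avOfRecord F N p.K k).avg U)) *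
      (chiSeqOfRecord F N ϑ.ν ϑ.τ9.M g p.K k s U * dressedSlotsOfDatum₉ F N ϑ D g₀ os t p g k s U) = _
  beta_reduce
  rw [Finset.mul_sum, ← Finset.sum_add_distrib]
  exact Finset.sum_congr rfl fun s _ => by ring

end Majorants

/-! ## §Q4 Each majorant family counts every cube at most twice along its own grid -/

section MajorantCounts

variable (F : T4Family) (N : ℕ) [NeZero N] (ϑ : Stage9Params F N) (D : FiniteEpsData F (SU N)) (g₀ : ℕ → ℝ) (os : List (ULoop F))
  (p : B12.RunParams) (g : ℕ → ℝ) (k : ℕ)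

/-- ★ **THE a-MAJORANTS ALONG THE (3.2) GRID**: `Σ_{i<m} ∫ collarA(θ_{i+2},θ_i)(Ū)·Σ_s h_s(U) dU ≤ 2(2L^m)⁴·Z` at the top `k + 1 = p.K` (U3's `sum_range_collarAt_cutGrid_le` and
`card_Iχ_top_le`; NO sign hypothesis on the letters; `0 ≤ ζ` for `h ≥ 0`). [bookkeeping] -/
theorem sum_range_majorantA_le (hk : k + 1 = p.K) (hζ0 : ∀ p g k s Pl Ql RS U V', 0 ≤ ϑ.ζ p g k s Pl Ql RS U V') (ρ : ℝ) (m : ℕ) (t : ℝ)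
    (hint : ∀ s : SeqOfRecord F ϑ.ν ϑ.τ9.M g p.K k,
      Integrable (fun U => chiSeqOfRecord F N ϑ.ν ϑ.τ9.M g p.K k s U * dressedSlotsOfDatum₉ F N ϑ D g₀ os t p g k s U) (fieldMeasure (F.P p.K) k (SU N))) :
    ∑ i ∈ Finset.range m, ∫ U, collarAt F N ϑ.ν p g k (cutGrid ϑ.ν g (k + 1) ρ (i + 2)) (cutGrid ϑ.ν g (k + 1) ρ i) ((avOfRecord F N p.K k).avg U) *
        ∑ s, chiSeqOfRecord F N ϑ.ν ϑ.τ9.M g p.K k s U * dressedSlotsOfDatum₉ F N ϑ D g₀ os t p g k s U ∂fieldMeasure (F.P p.K) k (SU N) ≤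
      2 * (2 * (F.L : ℝ) ^ F.m) ^ 4 * ∑ s, classWeightOfDatum₉ F N ϑ D g₀ os p g k t s := by
  set avg := (avOfRecord F N p.K k).avg with havg
  set old : GaugeField (F.P p.K) k (SU N) → ℝ := fun U =>
    ∑ s, chiSeqOfRecord F N ϑ.ν ϑ.τ9.M g p.K k s U * dressedSlotsOfDatum₉ F N ϑ D g₀ os t p g k s U with hold
  set B : ℕ → GaugeField (F.P p.K) (k + 1) (SU N) → ℝ := fun i V' =>
    collarAt F N ϑ.ν p g k (cutGrid ϑ.ν g (k + 1) ρ (i + 2)) (cutGrid ϑ.ν g (k + 1) ρ i) V' with hB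
  set C : ℝ := (Fintype.card (Iχ F ϑ.ν p g k) : ℝ) with hC
  have hold0 : ∀ U, 0 ≤ old U := fun U => Finset.sum_nonneg fun s _ => mul_nonneg (chiSeqOfRecord_nonneg F N ϑ.ν ϑ.τ9.M g p.K k s U)
    (dressedSlotsOfDatum₉_nonneg F N ϑ D g₀ os p g (wOfRecord₉_nonneg ϑ hζ0 p g) t k s U)
  have holdint : Integrable old (fieldMeasure (F.P p.K) k (SU N)) := integrable_finsetSum _ fun s _ => hint s
  have holdB : ∀ i, Integrable (fun U => B i (avg U) * old U) (fieldMeasure (F.P p.K) k (SU N)) := fun i =>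
    (holdint.bdd_mul (((measurable_collarAt F N ϑ.ν p g k _ _)).comp (avOfRecord_measurable F N p.K k)).aestronglyMeasurable
      (ae_of_all _ fun U => by rw [Real.norm_eq_abs]; exact abs_collarAt_le_card F N ϑ.ν p g k _ _ (avg U)))
  have hsumB : ∀ V', ∑ i ∈ Finset.range m, B i V' ≤ 2 * C := fun V' => sum_range_collarAt_cutGrid_le F N ϑ.ν p g k ρ m V'
  have hC4 : C ≤ (2 * (F.L : ℝ) ^ F.m) ^ 4 := card_Iχ_top_le F ϑ.ν p g k hk
  have hZ : ∫ U, old U ∂fieldMeasure (F.P p.K) k (SU N) = ∑ s, classWeightOfDatum₉ F N ϑ D g₀ os p g k t s := by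
    rw [hold, integral_finsetSum _ fun s _ => hint s]
    rfl
  have hZ0 : 0 ≤ ∑ s, classWeightOfDatum₉ F N ϑ D g₀ os p g k t s := by rw [← hZ]; exact integral_nonneg hold0
  calc ∑ i ∈ Finset.range m, ∫ U, B i (avg U) * old U ∂fieldMeasure (F.P p.K) k (SU N)
      = ∫ U, ∑ i ∈ Finset.range m, B i (avg U) * old U ∂fieldMeasure (F.P p.K) k (SU N) := (integral_finsetSum _ fun i _ => holdB i).symm
    _ ≤ ∫ U, (2 * C) * old U ∂fieldMeasure (F.P p.K) k (SU N) :=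
        integral_mono (integrable_finsetSum _ fun i _ => holdB i) (holdint.const_mul (2 * C)) fun U => by
          show ∑ i ∈ Finset.range m, B i (avg U) * old U ≤ 2 * C * old U
          rw [← Finset.sum_mul]
          exact mul_le_mul_of_nonneg_right (hsumB (avg U)) (hold0 U)
    _ = (2 * C) * ∑ s, classWeightOfDatum₉ F N ϑ D g₀ os p g k t s := by rw [integral_const_mul, hZ]
    _ ≤ 2 * (2 * (F.L : ℝ) ^ F.m) ^ 4 * ∑ s, classWeightOfDatum₉ F N ϑ D g₀ os p g k t s :=
        mul_le_mul_of_nonneg_right (by linarith) hZ0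

/-- ★ **THE b-MAJORANTS ALONG THE (3.3) GRID**: `Σ_{j<m} ∫ Σ_s collarB(δ′_{j+2},δ′_j)(s)(U,Ū)·h_s(U) dU ≤ 2(2L^m)⁴·Z` at the top `k + 1 = p.K` (§Q2 inside the `Σ_s`, `card_Iχ_top_le`;
NO sign hypothesis on the letters; `0 ≤ ζ` for `h ≥ 0`). [bookkeeping] -/
theorem sum_range_majorantB_le (hk : k + 1 = p.K) (hζ0 : ∀ p g k s Pl Ql RS U V', 0 ≤ ϑ.ζ p g k s Pl Ql RS U V') (ρ' : ℝ) (m : ℕ) (t : ℝ)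
    (hint : ∀ s : SeqOfRecord F ϑ.ν ϑ.τ9.M g p.K k,
      Integrable (fun U => chiSeqOfRecord F N ϑ.ν ϑ.τ9.M g p.K k s U * dressedSlotsOfDatum₉ F N ϑ D g₀ os t p g k s U) (fieldMeasure (F.P p.K) k (SU N))) :
    ∑ j ∈ Finset.range m, ∫ U, ∑ s, collarBAt F N ϑ.ν ϑ.τ9.M p g k (bCutGrid ϑ.ν ϑ.A₁ g k ρ' (j + 2)) (bCutGrid ϑ.ν ϑ.A₁ g k ρ' j) s U ((avOfRecord F N p.K k).avg U) *
        (chiSeqOfRecord F N ϑ.ν ϑ.τ9.M g p.K k s U * dressedSlotsOfDatum₉ F N ϑ D g₀ os t p g k s U) ∂fieldMeasure (F.P p.K) k (SU N) ≤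
      2 * (2 * (F.L : ℝ) ^ F.m) ^ 4 * ∑ s, classWeightOfDatum₉ F N ϑ D g₀ os p g k t s := by
  set avg := (avOfRecord F N p.K k).avg with havg
  set h : SeqOfRecord F ϑ.ν ϑ.τ9.M g p.K k → GaugeField (F.P p.K) k (SU N) → ℝ := fun s U =>
    chiSeqOfRecord F N ϑ.ν ϑ.τ9.M g p.K k s U * dressedSlotsOfDatum₉ F N ϑ D g₀ os t p g k s U with hh
  set B : ℕ → SeqOfRecord F ϑ.ν ϑ.τ9.M g p.K k → GaugeField (F.P p.K) k (SU N) → GaugeField (F.P p.K) (k + 1) (SU N) → ℝ := fun j s U V' =>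
    collarBAt F N ϑ.ν ϑ.τ9.M p g k (bCutGrid ϑ.ν ϑ.A₁ g k ρ' (j + 2)) (bCutGrid ϑ.ν ϑ.A₁ g k ρ' j) s U V' with hB
  set C : ℝ := (Fintype.card (Iχ F ϑ.ν p g k) : ℝ) with hC
  have hh0 : ∀ s U, 0 ≤ h s U := fun s U => mul_nonneg (chiSeqOfRecord_nonneg F N ϑ.ν ϑ.τ9.M g p.K k s U)
    (dressedSlotsOfDatum₉_nonneg F N ϑ D g₀ os p g (wOfRecord₉_nonneg ϑ hζ0 p g) t k s U)
  have hBint : ∀ j s, Integrable (fun U => B j s U (avg U) * h s U) (fieldMeasure (F.P p.K) k (SU N)) := fun j s =>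
    (integrable_oldPiece_mul_collarB F N ϑ D g₀ os p g k _ _ t hint s).congr (ae_of_all _ fun U => by rw [hB, hh]; ring)
  have hsumB : ∀ s U V', ∑ j ∈ Finset.range m, B j s U V' ≤ 2 * C := fun s U V' => sum_range_collarBAt_bCutGrid_le F N ϑ.ν ϑ.τ9.M ϑ.A₁ p g k ρ' m s U V'
  have hC4 : C ≤ (2 * (F.L : ℝ) ^ F.m) ^ 4 := card_Iχ_top_le F ϑ.ν p g k hk
  have hZ : ∫ U, ∑ s, h s U ∂fieldMeasure (F.P p.K) k (SU N) = ∑ s, classWeightOfDatum₉ F N ϑ D g₀ os p g k t s := by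
    rw [integral_finsetSum _ fun s _ => hint s]
    rfl
  have hZ0 : 0 ≤ ∑ s, classWeightOfDatum₉ F N ϑ D g₀ os p g k t s := by
    rw [← hZ]; exact integral_nonneg fun U => Finset.sum_nonneg fun s _ => hh0 s U
  have hsumint : Integrable (fun U => ∑ s, h s U) (fieldMeasure (F.P p.K) k (SU N)) := integrable_finsetSum _ fun s _ => hint s
  calc ∑ j ∈ Finset.range m, ∫ U, ∑ s, B j s U (avg U) * h s U ∂fieldMeasure (F.P p.K) k (SU N)
      = ∫ U, ∑ j ∈ Finset.range m, ∑ s, B j s U (avg U) * h s U ∂fieldMeasure (F.P p.K) k (SU N) :=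
        (integral_finsetSum _ fun j _ => integrable_finsetSum _ fun s _ => hBint j s).symm
    _ ≤ ∫ U, (2 * C) * ∑ s, h s U ∂fieldMeasure (F.P p.K) k (SU N) :=
        integral_mono (integrable_finsetSum _ fun j _ => integrable_finsetSum _ fun s _ => hBint j s) (hsumint.const_mul (2 * C)) fun U => by
          show ∑ j ∈ Finset.range m, ∑ s, B j s U (avg U) * h s U ≤ 2 * C * ∑ s, h s U
          rw [Finset.sum_comm, Finset.mul_sum]
          refine Finset.sum_le_sum fun s _ => ?_
          rw [← Finset.sum_mul]
          exact mul_le_mul_of_nonneg_right (hsumB s U (avg U)) (hh0 s U)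
    _ = (2 * C) * ∑ s, classWeightOfDatum₉ F N ϑ D g₀ os p g k t s := by rw [integral_const_mul, hZ]
    _ ≤ 2 * (2 * (F.L : ℝ) ^ F.m) ^ 4 * ∑ s, classWeightOfDatum₉ F N ϑ D g₀ os p g k t s :=
        mul_le_mul_of_nonneg_right (by linarith) hZ0

end MajorantCounts

/-! ## §Q5 The two depths, selected SEPARATELY, common to two runs — (M1)-FREE -/

section Select

variable (F : T4Family) (N : ℕ) [NeZero N] (ϑ : Stage9Params F N) (D : FiniteEpsData F (SU N)) (g₀ : ℕ → ℝ) (os : List (ULoop F))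

/-- ★★★ **TWO RUNS OF THE SAME TUPLE, ONE COMMON (3.2) DEPTH AND ONE COMMON (3.3) DEPTH** (run `r` at its top `k_r + 1 = p_r.K`; widths `ρ, ρ′ ∈ [0,1]`, depth budgets
`n₁, n₂`, one source `t`; signs `0 ≤ ε_top`, `0 ≤ δ_top` in both runs): some `i ≤ n₁` AND some `j ≤ n₂`, the SAME for both runs, have
`Σ_{s′} shell2ʳ(θʳ_{i+2}, θʳ_{i+1}, θʳ_i; δ′ʳ_{j+2}, δ′ʳ_{j+1}, δ′ʳ_j) ≤ 4(2L^m)⁴·(1∕(n₁+1) + 1∕(n₂+1))·Σ_s classWeightʳ_{k_r}(s)` in EACH run — `i` is the common argmin of the two runs'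
normalised a-majorants (§Q4, `…N21JointLetterSelection.exists_common_single_le`), `j` that of the b-majorants, and §Q3 adds them.  The two runs then read BOTH top indicator
families at COMMON relative letters `(1−ρ)^{i+1}ε_top`, `(1−ρ′)^{j+1}·2δ_top` with both collars EMPTY of top statistics on the doubly-gapped cores. [bookkeeping] -/
theorem exists_common_depths_topGap2Shell_le (p₁ : B12.RunParams) (g₁ : ℕ → ℝ) (k₁ : ℕ) (hk₁ : k₁ + 1 = p₁.K) (p₂ : B12.RunParams) (g₂ : ℕ → ℝ) (k₂ : ℕ)
    (hk₂ : k₂ + 1 = p₂.K)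
    (hζ0 : ∀ p g k s Pl Ql RS U V', 0 ≤ ϑ.ζ p g k s Pl Ql RS U V') (hζm : ZetaMeasurable F N ϑ.ζ) (hζ1 : IsZetaAbsLeOne F N ϑ.ν ϑ.τ9.M ϑ.ζ)
    (hζu : IsZetaUnity F N ϑ.ν ϑ.τ9.M ϑ.ζ) (hε₁ : 0 ≤ epsOfRecord ϑ.ν g₁ (k₁ + 1)) (hε₂ : 0 ≤ epsOfRecord ϑ.ν g₂ (k₂ + 1))
    (hδ₁ : 0 ≤ deltaOfRecord ϑ.ν g₁ k₁ ϑ.A₁) (hδ₂ : 0 ≤ deltaOfRecord ϑ.ν g₂ k₂ ϑ.A₁) {ρ ρ' : ℝ} (hρ0 : 0 ≤ ρ) (hρ1 : ρ ≤ 1) (hρ'0 : 0 ≤ ρ') (hρ'1 : ρ' ≤ 1)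
    (n₁ n₂ : ℕ) (t : ℝ)
    (hint₁ : ∀ s : SeqOfRecord F ϑ.ν ϑ.τ9.M g₁ p₁.K k₁,
      Integrable (fun U => chiSeqOfRecord F N ϑ.ν ϑ.τ9.M g₁ p₁.K k₁ s U * dressedSlotsOfDatum₉ F N ϑ D g₀ os t p₁ g₁ k₁ s U) (fieldMeasure (F.P p₁.K) k₁ (SU N)))
    (hint₂ : ∀ s : SeqOfRecord F ϑ.ν ϑ.τ9.M g₂ p₂.K k₂,
      Integrable (fun U => chiSeqOfRecord F N ϑ.ν ϑ.τ9.M g₂ p₂.K k₂ s U * dressedSlotsOfDatum₉ F N ϑ D g₀ os t p₂ g₂ k₂ s U) (fieldMeasure (F.P p₂.K) k₂ (SU N))) :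
    ∃ i ∈ Finset.range (n₁ + 1), ∃ j ∈ Finset.range (n₂ + 1),
      ∑ s', topGap2ShellAt F N ϑ D g₀ os p₁ g₁ k₁ (cutGrid ϑ.ν g₁ (k₁ + 1) ρ (i + 2)) (cutGrid ϑ.ν g₁ (k₁ + 1) ρ (i + 1)) (cutGrid ϑ.ν g₁ (k₁ + 1) ρ i)
          (bCutGrid ϑ.ν ϑ.A₁ g₁ k₁ ρ' (j + 2)) (bCutGrid ϑ.ν ϑ.A₁ g₁ k₁ ρ' (j + 1)) (bCutGrid ϑ.ν ϑ.A₁ g₁ k₁ ρ' j) t s' ≤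
          4 * (2 * (F.L : ℝ) ^ F.m) ^ 4 * (1 / (n₁ + 1 : ℕ) + 1 / (n₂ + 1 : ℕ)) * ∑ s, classWeightOfDatum₉ F N ϑ D g₀ os p₁ g₁ k₁ t s ∧
        ∑ s', topGap2ShellAt F N ϑ D g₀ os p₂ g₂ k₂ (cutGrid ϑ.ν g₂ (k₂ + 1) ρ (i + 2)) (cutGrid ϑ.ν g₂ (k₂ + 1) ρ (i + 1)) (cutGrid ϑ.ν g₂ (k₂ + 1) ρ i)
          (bCutGrid ϑ.ν ϑ.A₁ g₂ k₂ ρ' (j + 2)) (bCutGrid ϑ.ν ϑ.A₁ g₂ k₂ ρ' (j + 1)) (bCutGrid ϑ.ν ϑ.A₁ g₂ k₂ ρ' j) t s' ≤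
          4 * (2 * (F.L : ℝ) ^ F.m) ^ 4 * (1 / (n₁ + 1 : ℕ) + 1 / (n₂ + 1 : ℕ)) * ∑ s, classWeightOfDatum₉ F N ϑ D g₀ os p₂ g₂ k₂ t s := by
  -- the a-majorants and the b-majorants of the two runs along their grids
  set fa₁ : ℕ → ℝ := fun i => ∫ U, collarAt F N ϑ.ν p₁ g₁ k₁ (cutGrid ϑ.ν g₁ (k₁ + 1) ρ (i + 2)) (cutGrid ϑ.ν g₁ (k₁ + 1) ρ i) ((avOfRecord F N p₁.K k₁).avg U) *
    ∑ s, chiSeqOfRecord F N ϑ.ν ϑ.τ9.M g₁ p₁.K k₁ s U * dressedSlotsOfDatum₉ F N ϑ D g₀ os t p₁ g₁ k₁ s U ∂fieldMeasure (F.P p₁.K) k₁ (SU N) with hfa₁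
  set fa₂ : ℕ → ℝ := fun i => ∫ U, collarAt F N ϑ.ν p₂ g₂ k₂ (cutGrid ϑ.ν g₂ (k₂ + 1) ρ (i + 2)) (cutGrid ϑ.ν g₂ (k₂ + 1) ρ i) ((avOfRecord F N p₂.K k₂).avg U) *
    ∑ s, chiSeqOfRecord F N ϑ.ν ϑ.τ9.M g₂ p₂.K k₂ s U * dressedSlotsOfDatum₉ F N ϑ D g₀ os t p₂ g₂ k₂ s U ∂fieldMeasure (F.P p₂.K) k₂ (SU N) with hfa₂
  set fb₁ : ℕ → ℝ := fun j => ∫ U, ∑ s, collarBAt F N ϑ.ν ϑ.τ9.M p₁ g₁ k₁ (bCutGrid ϑ.ν ϑ.A₁ g₁ k₁ ρ' (j + 2)) (bCutGrid ϑ.ν ϑ.A₁ g₁ k₁ ρ' j) s U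
      ((avOfRecord F N p₁.K k₁).avg U) * (chiSeqOfRecord F N ϑ.ν ϑ.τ9.M g₁ p₁.K k₁ s U * dressedSlotsOfDatum₉ F N ϑ D g₀ os t p₁ g₁ k₁ s U)
    ∂fieldMeasure (F.P p₁.K) k₁ (SU N) with hfb₁
  set fb₂ : ℕ → ℝ := fun j => ∫ U, ∑ s, collarBAt F N ϑ.ν ϑ.τ9.M p₂ g₂ k₂ (bCutGrid ϑ.ν ϑ.A₁ g₂ k₂ ρ' (j + 2)) (bCutGrid ϑ.ν ϑ.A₁ g₂ k₂ ρ' j) s U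
      ((avOfRecord F N p₂.K k₂).avg U) * (chiSeqOfRecord F N ϑ.ν ϑ.τ9.M g₂ p₂.K k₂ s U * dressedSlotsOfDatum₉ F N ϑ D g₀ os t p₂ g₂ k₂ s U)
    ∂fieldMeasure (F.P p₂.K) k₂ (SU N) with hfb₂
  set Z₁ : ℝ := ∑ s, classWeightOfDatum₉ F N ϑ D g₀ os p₁ g₁ k₁ t s with hZ₁
  set Z₂ : ℝ := ∑ s, classWeightOfDatum₉ F N ϑ D g₀ os p₂ g₂ k₂ t s with hZ₂
  set X : ℝ := (2 * (F.L : ℝ) ^ F.m) ^ 4 with hX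
  -- monotone grids (signs)
  have hθ₁ : ∀ i, cutGrid ϑ.ν g₁ (k₁ + 1) ρ (i + 1) ≤ cutGrid ϑ.ν g₁ (k₁ + 1) ρ i := fun i => cutGrid_succ_le_of_nonneg ϑ.ν (k₁ + 1) hε₁ hρ0 hρ1 i
  have hθ₂ : ∀ i, cutGrid ϑ.ν g₂ (k₂ + 1) ρ (i + 1) ≤ cutGrid ϑ.ν g₂ (k₂ + 1) ρ i := fun i => cutGrid_succ_le_of_nonneg ϑ.ν (k₂ + 1) hε₂ hρ0 hρ1 i
  have hδ'₁ : ∀ j, bCutGrid ϑ.ν ϑ.A₁ g₁ k₁ ρ' (j + 1) ≤ bCutGrid ϑ.ν ϑ.A₁ g₁ k₁ ρ' j := fun j => bCutGrid_succ_le_of_nonneg ϑ.ν ϑ.A₁ g₁ k₁ hδ₁ hρ'0 hρ'1 j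
  have hδ'₂ : ∀ j, bCutGrid ϑ.ν ϑ.A₁ g₂ k₂ ρ' (j + 1) ≤ bCutGrid ϑ.ν ϑ.A₁ g₂ k₂ ρ' j := fun j => bCutGrid_succ_le_of_nonneg ϑ.ν ϑ.A₁ g₂ k₂ hδ₂ hρ'0 hρ'1 j
  have hw₁ : ∀ k s' U V', 0 ≤ wOfRecord₉ F N ϑ p₁ g₁ k s' U V' := wOfRecord₉_nonneg ϑ hζ0 p₁ g₁
  have hw₂ : ∀ k s' U V', 0 ≤ wOfRecord₉ F N ϑ p₂ g₂ k s' U V' := wOfRecord₉_nonneg ϑ hζ0 p₂ g₂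
  have hfa₁0 : ∀ i ∈ Finset.range (n₁ + 1), 0 ≤ fa₁ i := fun i _ => integral_nonneg fun U =>
    mul_nonneg (collarAt_nonneg F N ϑ.ν p₁ g₁ k₁ ((hθ₁ (i + 1)).trans (hθ₁ i)) _) (Finset.sum_nonneg fun s _ =>
      mul_nonneg (chiSeqOfRecord_nonneg F N ϑ.ν ϑ.τ9.M g₁ p₁.K k₁ s U) (dressedSlotsOfDatum₉_nonneg F N ϑ D g₀ os p₁ g₁ hw₁ t k₁ s U))
  have hfa₂0 : ∀ i ∈ Finset.range (n₁ + 1), 0 ≤ fa₂ i := fun i _ => integral_nonneg fun U =>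
    mul_nonneg (collarAt_nonneg F N ϑ.ν p₂ g₂ k₂ ((hθ₂ (i + 1)).trans (hθ₂ i)) _) (Finset.sum_nonneg fun s _ =>
      mul_nonneg (chiSeqOfRecord_nonneg F N ϑ.ν ϑ.τ9.M g₂ p₂.K k₂ s U) (dressedSlotsOfDatum₉_nonneg F N ϑ D g₀ os p₂ g₂ hw₂ t k₂ s U))
  have hfb₁0 : ∀ j ∈ Finset.range (n₂ + 1), 0 ≤ fb₁ j := fun j _ => integral_nonneg fun U => Finset.sum_nonneg fun s _ =>
    mul_nonneg (collarBAt_nonneg F N ϑ.ν ϑ.τ9.M p₁ g₁ k₁ ((hδ'₁ (j + 1)).trans (hδ'₁ j)) s U _)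
      (mul_nonneg (chiSeqOfRecord_nonneg F N ϑ.ν ϑ.τ9.M g₁ p₁.K k₁ s U) (dressedSlotsOfDatum₉_nonneg F N ϑ D g₀ os p₁ g₁ hw₁ t k₁ s U))
  have hfb₂0 : ∀ j ∈ Finset.range (n₂ + 1), 0 ≤ fb₂ j := fun j _ => integral_nonneg fun U => Finset.sum_nonneg fun s _ =>
    mul_nonneg (collarBAt_nonneg F N ϑ.ν ϑ.τ9.M p₂ g₂ k₂ ((hδ'₂ (j + 1)).trans (hδ'₂ j)) s U _)
      (mul_nonneg (chiSeqOfRecord_nonneg F N ϑ.ν ϑ.τ9.M g₂ p₂.K k₂ s U) (dressedSlotsOfDatum₉_nonneg F N ϑ D g₀ os p₂ g₂ hw₂ t k₂ s U))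
  have hsa₁ : ∑ i ∈ Finset.range (n₁ + 1), fa₁ i ≤ 2 * X * Z₁ := sum_range_majorantA_le F N ϑ D g₀ os p₁ g₁ k₁ hk₁ hζ0 ρ (n₁ + 1) t hint₁
  have hsa₂ : ∑ i ∈ Finset.range (n₁ + 1), fa₂ i ≤ 2 * X * Z₂ := sum_range_majorantA_le F N ϑ D g₀ os p₂ g₂ k₂ hk₂ hζ0 ρ (n₁ + 1) t hint₂
  have hsb₁ : ∑ j ∈ Finset.range (n₂ + 1), fb₁ j ≤ 2 * X * Z₁ := sum_range_majorantB_le F N ϑ D g₀ os p₁ g₁ k₁ hk₁ hζ0 ρ' (n₂ + 1) t hint₁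
  have hsb₂ : ∑ j ∈ Finset.range (n₂ + 1), fb₂ j ≤ 2 * X * Z₂ := sum_range_majorantB_le F N ϑ D g₀ os p₂ g₂ k₂ hk₂ hζ0 ρ' (n₂ + 1) t hint₂
  -- two independent common argmins
  obtain ⟨i, hi, hia₁, hia₂⟩ := exists_common_single_le hfa₁0 hfa₂0 hsa₁ hsa₂
  obtain ⟨j, hj, hjb₁, hjb₂⟩ := exists_common_single_le hfb₁0 hfb₂0 hsb₁ hsb₂
  -- §Q3 in each run at the selected letters
  have hM₁ := sum_topGap2ShellAt_le_majorants F N ϑ D g₀ os p₁ g₁ k₁ hk₁ hζ0 hζm hζ1 hζu (hθ₁ (i + 1)) (hθ₁ i) (hδ'₁ (j + 1)) (hδ'₁ j) t hint₁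
  have hM₂ := sum_topGap2ShellAt_le_majorants F N ϑ D g₀ os p₂ g₂ k₂ hk₂ hζ0 hζm hζ1 hζu (hθ₂ (i + 1)) (hθ₂ i) (hδ'₂ (j + 1)) (hδ'₂ j) t hint₂
  have hnum : ∀ Z : ℝ, 2 * (2 * X) / (n₁ + 1 : ℕ) * Z + 2 * (2 * X) / (n₂ + 1 : ℕ) * Z = 4 * X * (1 / (n₁ + 1 : ℕ) + 1 / (n₂ + 1 : ℕ)) * Z := fun Z => by ring
  refine ⟨i, hi, j, hj, ?_, ?_⟩
  · calc _ ≤ fa₁ i + fb₁ j := hM₁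
      _ ≤ 2 * (2 * X) / (n₁ + 1 : ℕ) * Z₁ + 2 * (2 * X) / (n₂ + 1 : ℕ) * Z₁ := add_le_add hia₁ hjb₁
      _ = 4 * X * (1 / (n₁ + 1 : ℕ) + 1 / (n₂ + 1 : ℕ)) * Z₁ := hnum Z₁
  · calc _ ≤ fa₂ i + fb₂ j := hM₂
      _ ≤ 2 * (2 * X) / (n₁ + 1 : ℕ) * Z₂ + 2 * (2 * X) / (n₂ + 1 : ℕ) * Z₂ := add_le_add hia₂ hjb₂
      _ = 4 * X * (1 / (n₁ + 1 : ℕ) + 1 / (n₂ + 1 : ℕ)) * Z₂ := hnum Z₂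

end Select

end Summit.QuantumFields.YangMills.Theorems.N21GappedTopPair13CoPH

end
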